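import Mathlib.Analysis.Convex.Deriv
import Mathlib.Analysis.SpecialFunctions.Log.Deriv
import Mathlib.Analysis.SpecialFunctions.ExpDeriv
import Mathlib.Analysis.SpecialFunctions.Pow.Real
import Mathlib.Analysis.SpecialFunctions.Sqrt
import HarnessLib

/-!
# The convex-chord lemma for the sextic isolation law `(Q6)_port` along one pair weight

Support file for crux `stmt-CriticalPhenomena-4575` (`NoHeavyLowerTail`), seat `prim-facecert` gen 20
(`--supports stmt-CriticalPhenomena-4575`; paper proof prim-l12-p1 gen 22, memo
`run/shared/lean/prim/prim-l12/FROM-prim-l12-p1-g22-CHALF-ALL-GRAPHS.md` §8; this is its step "CLAIM XS ⇒ convexity ⇒ chord",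
the algebra of `…ThreePointIsoSexticPendantConvex` (prim-l12-p1 gen 22) with GENERAL affine coordinates).  No definitions, no sorries.

Along the weight `r ∈ [0,1]` of one pair of a finite weighted graph the isolation coordinates of three vertices `a, b, c`
— `Q = P(a|b|c)`, `A = I_a = P(a ↮ {b,c})`, `B = I_b`, `C = I_c` — are AFFINE: `Q(r) = (1-r)Q₀ + rQ₁` etc.
**Theorem (`sextic_chord`).**  Let `0 < Q₁ ≤ Q₀`, `0 < A₁ ≤ A₀`, `0 < B₁ ≤ B₀`, `0 ≤ C₀, C₁`, suppose the sextic law holds at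
both ends, `Q₀⁶ ≤ A₀³B₀³C₀²` and `Q₁⁶ ≤ A₁³B₁³C₁²`, and suppose the CROSS CONDITION
`XS(s) : Q(s)·((A₀-A₁)·B(s) + (B₀-B₁)·A(s)) ≤ (Q₀-Q₁)·A(s)·B(s)` for all `s ∈ [0,1]`
(i.e. `ΔA/A(s) + ΔB/B(s) ≤ ΔQ/Q(s)`).  Then `Q(r)⁶ ≤ A(r)³B(r)³C(r)²` for every `r ∈ [0,1]`.
Proof: in normalised decrements `d = ΔQ/Q₀`, `a = ΔA/A₀`, `b = ΔB/B₀` the function `Φ(p) = (1-pd)³/((1-pa)(1-pb))^{3/2}`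
is CONVEX on `[0,1]` — `Φ = exp φ`, `Φ'' = Φ(φ'' + φ'²)` and `φ'' + φ'² = ¾(A-B)² + 3(X-S)(2X-S) ≥ 0` with `X = d/(1-pd)`,
`A = a/(1-pa)`, `B = b/(1-pb)`, `S = A + B ≤ X` (= `XS`) — so `Φ ≤` its chord, and the two endpoint inequalities are the
hypotheses.  `sextic_chord_of_cov` is the form fed by the graph side: `XS` follows from the two BHK-type covariance
inequalities `K_a = ΔQ_a·A₀ - ΔA·Q₀ ≥ 0`, `K_b = ΔQ_b·B₀ - ΔB·Q₀ ≥ 0` with `ΔQ_a + ΔQ_b = ΔQ`, `ΔQ_a, ΔQ_b ≥ 0`.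
-/

namespace Summit.CriticalPhenomena.PercolationContinuityZ3.Theorems.ThreePointIsoSexticChord

open Set Real

/-! ## Calculus: `Φ = exp ∘ φ`, `φ(p) = 3 log(1-pd) - 3/2 log(1-pa) - 3/2 log(1-pb)` -/

/-- Derivative of `φ`. [this work] -/
theorem hasDerivAt_phi {a b d p : ℝ} (h1 : 1 - p * d ≠ 0) (h2 : 1 - p * a ≠ 0) (h3 : 1 - p * b ≠ 0) :
    HasDerivAt (fun p => 3 * log (1 - p * d) - 3 / 2 * log (1 - p * a) - 3 / 2 * log (1 - p * b))
      (3 * (-d / (1 - p * d)) - 3 / 2 * (-a / (1 - p * a)) - 3 / 2 * (-b / (1 - p * b))) p := by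
  have e1 : HasDerivAt (fun p => 1 - p * d) (-d) p := (hasDerivAt_mul_const d).const_sub 1
  have e2 : HasDerivAt (fun p => 1 - p * a) (-a) p := (hasDerivAt_mul_const a).const_sub 1
  have e3 : HasDerivAt (fun p => 1 - p * b) (-b) p := (hasDerivAt_mul_const b).const_sub 1
  exact (((e1.log h1).const_mul 3).fun_sub ((e2.log h2).const_mul (3 / 2))).fun_sub ((e3.log h3).const_mul (3 / 2))

/-- Derivative of `φ'`. [this work] -/
theorem hasDerivAt_phi1 {a b d p : ℝ} (h1 : 1 - p * d ≠ 0) (h2 : 1 - p * a ≠ 0) (h3 : 1 - p * b ≠ 0) :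
    HasDerivAt (fun p => 3 * (-d / (1 - p * d)) - 3 / 2 * (-a / (1 - p * a)) - 3 / 2 * (-b / (1 - p * b)))
      (3 * (-d ^ 2 / (1 - p * d) ^ 2) - 3 / 2 * (-a ^ 2 / (1 - p * a) ^ 2)
        - 3 / 2 * (-b ^ 2 / (1 - p * b) ^ 2)) p := by
  have e1 : HasDerivAt (fun p => 1 - p * d) (-d) p := (hasDerivAt_mul_const d).const_sub 1
  have e2 : HasDerivAt (fun p => 1 - p * a) (-a) p := (hasDerivAt_mul_const a).const_sub 1
  have e3 : HasDerivAt (fun p => 1 - p * b) (-b) p := (hasDerivAt_mul_const b).const_sub 1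
  have d1 : HasDerivAt (fun p => -d / (1 - p * d)) (-d ^ 2 / (1 - p * d) ^ 2) p := by
    have h0 := (hasDerivAt_const p (-d)).fun_div e1 h1
    simp only [zero_mul, zero_sub] at h0
    refine h0.congr_deriv ?_
    ring
  have d2 : HasDerivAt (fun p => -a / (1 - p * a)) (-a ^ 2 / (1 - p * a) ^ 2) p := by
    have h0 := (hasDerivAt_const p (-a)).fun_div e2 h2
    simp only [zero_mul, zero_sub] at h0
    refine h0.congr_deriv ?_
    ring
  have d3 : HasDerivAt (fun p => -b / (1 - p * b)) (-b ^ 2 / (1 - p * b) ^ 2) p := by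
    have h0 := (hasDerivAt_const p (-b)).fun_div e3 h3
    simp only [zero_mul, zero_sub] at h0
    refine h0.congr_deriv ?_
    ring
  exact ((d1.const_mul 3).fun_sub (d2.const_mul (3 / 2))).fun_sub (d3.const_mul (3 / 2))

/-- The key identity and sign: `φ'' + φ'² = ¾(A−B)² + 3(X−S)(2X−S) ≥ 0` with `X = d/(1−pd)`, `A = a/(1−pa)`,
`B = b/(1−pb)`, `S = A + B`, GIVEN the cross condition `S ≤ X` in polynomial form
`a(1−pb)(1−pd) + b(1−pa)(1−pd) ≤ d(1−pa)(1−pb)`. [this work] -/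
theorem phi_key {a b d p : ℝ} (hd : 0 ≤ d) (h1 : 0 < 1 - p * d) (h2 : 0 < 1 - p * a) (h3 : 0 < 1 - p * b)
    (hXS : a * (1 - p * b) * (1 - p * d) + b * (1 - p * a) * (1 - p * d) ≤ d * (1 - p * a) * (1 - p * b)) :
    0 ≤ (3 * (-d / (1 - p * d)) - 3 / 2 * (-a / (1 - p * a)) - 3 / 2 * (-b / (1 - p * b))) ^ 2 +
      (3 * (-d ^ 2 / (1 - p * d) ^ 2) - 3 / 2 * (-a ^ 2 / (1 - p * a) ^ 2)
        - 3 / 2 * (-b ^ 2 / (1 - p * b) ^ 2)) := by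
  set X : ℝ := d / (1 - p * d) with hX
  set A : ℝ := a / (1 - p * a) with hA
  set B : ℝ := b / (1 - p * b) with hB
  have eX : -d / (1 - p * d) = -X := by rw [hX, neg_div]
  have eA : -a / (1 - p * a) = -A := by rw [hA, neg_div]
  have eB : -b / (1 - p * b) = -B := by rw [hB, neg_div]
  have eX2 : -d ^ 2 / (1 - p * d) ^ 2 = -X ^ 2 := by rw [hX, neg_div, div_pow]
  have eA2 : -a ^ 2 / (1 - p * a) ^ 2 = -A ^ 2 := by rw [hA, neg_div, div_pow]
  have eB2 : -b ^ 2 / (1 - p * b) ^ 2 = -B ^ 2 := by rw [hB, neg_div, div_pow]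
  rw [eX, eA, eB, eX2, eA2, eB2]
  have hX0 : 0 ≤ X := div_nonneg hd h1.le
  -- the cross condition says `A + B ≤ X`
  have hS : A + B ≤ X := by
    rw [hA, hB, hX, div_add_div _ _ h2.ne' h3.ne', div_le_div_iff₀ (mul_pos h2 h3) h1]
    nlinarith [hXS]
  have key : (3 * -X - 3 / 2 * -A - 3 / 2 * -B) ^ 2 + (3 * -X ^ 2 - 3 / 2 * -A ^ 2 - 3 / 2 * -B ^ 2) =
      3 / 4 * (A - B) ^ 2 + 3 * ((X - (A + B)) * (2 * X - (A + B))) := by ring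
  rw [key]
  have h4 : 0 ≤ (X - (A + B)) * (2 * X - (A + B)) := mul_nonneg (by linarith) (by linarith)
  positivity

/-- **Convexity of `Φ(p) = (1−pd)³/((1−pa)(1−pb))^{3/2}` on `[0,1]`** under the cross condition (`0 ≤ a, b, d < 1`). [this work] -/
theorem convexOn_Phi {a b d : ℝ} (ha : 0 ≤ a) (hb : 0 ≤ b) (hd : 0 ≤ d) (ha1 : a < 1) (hb1 : b < 1) (hd1 : d < 1)
    (hXS : ∀ p ∈ Icc (0 : ℝ) 1, a * (1 - p * b) * (1 - p * d) + b * (1 - p * a) * (1 - p * d) ≤ d * (1 - p * a) * (1 - p * b)) :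
    ConvexOn ℝ (Icc (0 : ℝ) 1)
      (fun p => exp (3 * log (1 - p * d) - 3 / 2 * log (1 - p * a) - 3 / 2 * log (1 - p * b))) := by
  have pos : ∀ p ∈ Icc (0 : ℝ) 1, 0 < 1 - p * d ∧ 0 < 1 - p * a ∧ 0 < 1 - p * b := by
    intro p hp
    obtain ⟨hp0, hp1⟩ := hp
    refine ⟨?_, ?_, ?_⟩
    · nlinarith [mul_nonneg hp0 hd, mul_le_mul_of_nonneg_right hp1 hd]
    · nlinarith [mul_nonneg hp0 ha, mul_le_mul_of_nonneg_right hp1 ha]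
    · nlinarith [mul_nonneg hp0 hb, mul_le_mul_of_nonneg_right hp1 hb]
  refine convexOn_of_hasDerivWithinAt2_nonneg (convex_Icc 0 1)
    (f' := fun p => exp (3 * log (1 - p * d) - 3 / 2 * log (1 - p * a) - 3 / 2 * log (1 - p * b)) *
      (3 * (-d / (1 - p * d)) - 3 / 2 * (-a / (1 - p * a)) - 3 / 2 * (-b / (1 - p * b))))
    (f'' := fun p => exp (3 * log (1 - p * d) - 3 / 2 * log (1 - p * a) - 3 / 2 * log (1 - p * b)) *
      (3 * (-d / (1 - p * d)) - 3 / 2 * (-a / (1 - p * a)) - 3 / 2 * (-b / (1 - p * b))) *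
      (3 * (-d / (1 - p * d)) - 3 / 2 * (-a / (1 - p * a)) - 3 / 2 * (-b / (1 - p * b))) +
      exp (3 * log (1 - p * d) - 3 / 2 * log (1 - p * a) - 3 / 2 * log (1 - p * b)) *
      (3 * (-d ^ 2 / (1 - p * d) ^ 2) - 3 / 2 * (-a ^ 2 / (1 - p * a) ^ 2)
        - 3 / 2 * (-b ^ 2 / (1 - p * b) ^ 2)))
    ?_ ?_ ?_ ?_
  · intro p hp
    obtain ⟨h1, h2, h3⟩ := pos p hp
    exact ((hasDerivAt_phi h1.ne' h2.ne' h3.ne').exp).continuousAt.continuousWithinAt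
  · intro p hp
    rw [interior_Icc] at hp
    obtain ⟨h1, h2, h3⟩ := pos p (Ioo_subset_Icc_self hp)
    exact ((hasDerivAt_phi h1.ne' h2.ne' h3.ne').exp).hasDerivWithinAt
  · intro p hp
    rw [interior_Icc] at hp
    obtain ⟨h1, h2, h3⟩ := pos p (Ioo_subset_Icc_self hp)
    exact (((hasDerivAt_phi h1.ne' h2.ne' h3.ne').exp).fun_mul (hasDerivAt_phi1 h1.ne' h2.ne' h3.ne')).hasDerivWithinAt
  · intro p hp
    rw [interior_Icc] at hp
    obtain ⟨h1, h2, h3⟩ := pos p (Ioo_subset_Icc_self hp)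
    have hk := phi_key hd h1 h2 h3 (hXS p (Ioo_subset_Icc_self hp))
    set E := exp (3 * log (1 - p * d) - 3 / 2 * log (1 - p * a) - 3 / 2 * log (1 - p * b)) with hEdef
    set F1 := 3 * (-d / (1 - p * d)) - 3 / 2 * (-a / (1 - p * a)) - 3 / 2 * (-b / (1 - p * b)) with hF1
    set F2 := 3 * (-d ^ 2 / (1 - p * d) ^ 2) - 3 / 2 * (-a ^ 2 / (1 - p * a) ^ 2)
        - 3 / 2 * (-b ^ 2 / (1 - p * b) ^ 2) with hF2
    have hE : 0 ≤ E := (exp_pos _).le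
    have e : E * F1 * F1 + E * F2 = E * (F1 ^ 2 + F2) := by ring
    rw [e]
    exact mul_nonneg hE hk

/-- The square of `Φ` is the rational function `(1−pd)⁶/((1−pa)³(1−pb)³)`. [this work] -/
theorem Phi_sq {a b d p : ℝ} (h1 : 0 < 1 - p * d) (h2 : 0 < 1 - p * a) (h3 : 0 < 1 - p * b) :
    exp (3 * log (1 - p * d) - 3 / 2 * log (1 - p * a) - 3 / 2 * log (1 - p * b)) ^ 2 =
      (1 - p * d) ^ 6 / ((1 - p * a) ^ 3 * (1 - p * b) ^ 3) := by
  rw [← exp_nat_mul]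
  have e : ((2 : ℕ) : ℝ) * (3 * log (1 - p * d) - 3 / 2 * log (1 - p * a) - 3 / 2 * log (1 - p * b)) =
      ((6 : ℕ) : ℝ) * log (1 - p * d) - (((3 : ℕ) : ℝ) * log (1 - p * a) + ((3 : ℕ) : ℝ) * log (1 - p * b)) := by
    push_cast; ring
  rw [e, exp_sub, exp_add, exp_nat_mul, exp_nat_mul, exp_nat_mul, exp_log h1, exp_log h2, exp_log h3]

/-- **Chord inequality**: `Φ(p) ≤ (1 − p)·Φ(0) + p·Φ(1) = 1 − p + p·Φ(1)` on `[0,1]`. [this work] -/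
theorem Phi_le_chord {a b d p : ℝ} (ha : 0 ≤ a) (hb : 0 ≤ b) (hd : 0 ≤ d) (ha1 : a < 1) (hb1 : b < 1) (hd1 : d < 1)
    (hXS : ∀ p ∈ Icc (0 : ℝ) 1, a * (1 - p * b) * (1 - p * d) + b * (1 - p * a) * (1 - p * d) ≤ d * (1 - p * a) * (1 - p * b))
    (hp0 : 0 ≤ p) (hp1 : p ≤ 1) :
    exp (3 * log (1 - p * d) - 3 / 2 * log (1 - p * a) - 3 / 2 * log (1 - p * b)) ≤
      1 - p + p * exp (3 * log (1 - 1 * d) - 3 / 2 * log (1 - 1 * a) - 3 / 2 * log (1 - 1 * b)) := by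
  have hc := (convexOn_Phi ha hb hd ha1 hb1 hd1 hXS).2 (left_mem_Icc.2 zero_le_one) (right_mem_Icc.2 zero_le_one)
    (sub_nonneg.2 hp1) hp0 (sub_add_cancel 1 p)
  simp only [smul_eq_mul, mul_zero, mul_one, zero_add, zero_mul, sub_zero, log_one] at hc
  simpa using hc

/-! ## The sextic law along an affine segment -/

/-- **The convex-chord lemma for `(Q6)_port`** (see the module docstring). [this work] -/
theorem sextic_chord {Q₀ Q₁ A₀ A₁ B₀ B₁ C₀ C₁ r : ℝ}
    (hQ₁ : 0 < Q₁) (hQ : Q₁ ≤ Q₀) (hA₁ : 0 < A₁) (hA : A₁ ≤ A₀) (hB₁ : 0 < B₁) (hB : B₁ ≤ B₀)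
    (hC₀ : 0 ≤ C₀) (hC₁ : 0 ≤ C₁)
    (hXS : ∀ s ∈ Icc (0 : ℝ) 1,
      ((1 - s) * Q₀ + s * Q₁) * ((A₀ - A₁) * ((1 - s) * B₀ + s * B₁) + (B₀ - B₁) * ((1 - s) * A₀ + s * A₁)) ≤
        (Q₀ - Q₁) * ((1 - s) * A₀ + s * A₁) * ((1 - s) * B₀ + s * B₁))
    (h0 : Q₀ ^ 6 ≤ A₀ ^ 3 * B₀ ^ 3 * C₀ ^ 2) (h1 : Q₁ ^ 6 ≤ A₁ ^ 3 * B₁ ^ 3 * C₁ ^ 2)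
    (hr0 : 0 ≤ r) (hr1 : r ≤ 1) :
    ((1 - r) * Q₀ + r * Q₁) ^ 6 ≤
      ((1 - r) * A₀ + r * A₁) ^ 3 * ((1 - r) * B₀ + r * B₁) ^ 3 * ((1 - r) * C₀ + r * C₁) ^ 2 := by
  have hQ₀ : 0 < Q₀ := lt_of_lt_of_le hQ₁ hQ
  have hA₀ : 0 < A₀ := lt_of_lt_of_le hA₁ hA
  have hB₀ : 0 < B₀ := lt_of_lt_of_le hB₁ hB
  -- normalised decrements
  set d := (Q₀ - Q₁) / Q₀ with hdd
  set a := (A₀ - A₁) / A₀ with haa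
  set b := (B₀ - B₁) / B₀ with hbb
  have hd : 0 ≤ d := div_nonneg (sub_nonneg.2 hQ) hQ₀.le
  have ha : 0 ≤ a := div_nonneg (sub_nonneg.2 hA) hA₀.le
  have hb : 0 ≤ b := div_nonneg (sub_nonneg.2 hB) hB₀.le
  have hd1 : d < 1 := by rw [hdd, div_lt_one hQ₀]; linarith
  have ha1 : a < 1 := by rw [haa, div_lt_one hA₀]; linarith
  have hb1 : b < 1 := by rw [hbb, div_lt_one hB₀]; linarith
  -- the affine coordinates in normalised form
  have eQ : ∀ s : ℝ, (1 - s) * Q₀ + s * Q₁ = Q₀ * (1 - s * d) := fun s => by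
    rw [hdd]; field_simp; ring
  have eA : ∀ s : ℝ, (1 - s) * A₀ + s * A₁ = A₀ * (1 - s * a) := fun s => by
    rw [haa]; field_simp; ring
  have eB : ∀ s : ℝ, (1 - s) * B₀ + s * B₁ = B₀ * (1 - s * b) := fun s => by
    rw [hbb]; field_simp; ring
  have eQd : Q₀ - Q₁ = Q₀ * d := by rw [hdd]; field_simp
  have eAd : A₀ - A₁ = A₀ * a := by rw [haa]; field_simp
  have eBd : B₀ - B₁ = B₀ * b := by rw [hbb]; field_simp
  -- the normalised cross condition
  have hXS' : ∀ p ∈ Icc (0 : ℝ) 1,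
      a * (1 - p * b) * (1 - p * d) + b * (1 - p * a) * (1 - p * d) ≤ d * (1 - p * a) * (1 - p * b) := by
    intro p hp
    have h := hXS p hp
    rw [eQ, eA, eB, eQd, eAd, eBd] at h
    have hpos : 0 < Q₀ * A₀ * B₀ := by positivity
    have h' : Q₀ * A₀ * B₀ * (a * (1 - p * b) * (1 - p * d) + b * (1 - p * a) * (1 - p * d)) ≤
        Q₀ * A₀ * B₀ * (d * (1 - p * a) * (1 - p * b)) := by nlinarith [h]
    exact le_of_mul_le_mul_left h' hpos
  -- positivity of the normalised factors on `[0,1]`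
  have pos : ∀ p : ℝ, 0 ≤ p → p ≤ 1 → 0 < 1 - p * d ∧ 0 < 1 - p * a ∧ 0 < 1 - p * b := by
    intro p hp0 hp1
    refine ⟨?_, ?_, ?_⟩
    · nlinarith [mul_nonneg hp0 hd, mul_le_mul_of_nonneg_right hp1 hd]
    · nlinarith [mul_nonneg hp0 ha, mul_le_mul_of_nonneg_right hp1 ha]
    · nlinarith [mul_nonneg hp0 hb, mul_le_mul_of_nonneg_right hp1 hb]
  obtain ⟨g1, g2, g3⟩ := pos r hr0 hr1
  obtain ⟨f1, f2, f3⟩ := pos 1 zero_le_one le_rfl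
  -- `κ = Q₀³/(A₀B₀)^{3/2}` via its square
  set κ := Real.sqrt (Q₀ ^ 6 / (A₀ ^ 3 * B₀ ^ 3)) with hκ
  have hκ0 : 0 ≤ κ := Real.sqrt_nonneg _
  have hden : 0 < A₀ ^ 3 * B₀ ^ 3 := by positivity
  have hκsq : κ ^ 2 = Q₀ ^ 6 / (A₀ ^ 3 * B₀ ^ 3) := by
    rw [hκ, Real.sq_sqrt (div_nonneg (by positivity) hden.le)]
  set Φr := exp (3 * log (1 - r * d) - 3 / 2 * log (1 - r * a) - 3 / 2 * log (1 - r * b)) with hΦr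
  set Φ1 := exp (3 * log (1 - 1 * d) - 3 / 2 * log (1 - 1 * a) - 3 / 2 * log (1 - 1 * b)) with hΦ1
  have hΦr0 : 0 ≤ Φr := (exp_pos _).le
  have hΦ10 : 0 ≤ Φ1 := (exp_pos _).le
  have hΦrsq : Φr ^ 2 = (1 - r * d) ^ 6 / ((1 - r * a) ^ 3 * (1 - r * b) ^ 3) := Phi_sq g1 g2 g3
  have hΦ1sq : Φ1 ^ 2 = (1 - 1 * d) ^ 6 / ((1 - 1 * a) ^ 3 * (1 - 1 * b) ^ 3) := Phi_sq f1 f2 f3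
  -- endpoint inequalities: `κ ≤ C₀`, `κ Φ(1) ≤ C₁`
  have hκC₀ : κ ≤ C₀ := by
    have : κ ^ 2 ≤ C₀ ^ 2 := by
      rw [hκsq, div_le_iff₀ hden]; nlinarith [h0]
    exact (pow_le_pow_iff_left₀ hκ0 hC₀ two_ne_zero).1 this
  have hκC₁ : κ * Φ1 ≤ C₁ := by
    have hden1 : 0 < (1 - 1 * a) ^ 3 * (1 - 1 * b) ^ 3 := by positivity
    have : (κ * Φ1) ^ 2 ≤ C₁ ^ 2 := by
      rw [mul_pow, hκsq, hΦ1sq, div_mul_div_comm, div_le_iff₀ (mul_pos hden hden1)]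
      -- `Q₀⁶ (1-d)⁶ = Q₁⁶`, `A₀³(1-a)³ = A₁³`, `B₀³(1-b)³ = B₁³`
      have e1 : Q₀ * (1 - 1 * d) = Q₁ := by rw [hdd]; field_simp; ring
      have e2 : A₀ * (1 - 1 * a) = A₁ := by rw [haa]; field_simp; ring
      have e3 : B₀ * (1 - 1 * b) = B₁ := by rw [hbb]; field_simp; ring
      calc Q₀ ^ 6 * (1 - 1 * d) ^ 6 = (Q₀ * (1 - 1 * d)) ^ 6 := by ring
        _ = Q₁ ^ 6 := by rw [e1]
        _ ≤ A₁ ^ 3 * B₁ ^ 3 * C₁ ^ 2 := h1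
        _ = (A₀ * (1 - 1 * a)) ^ 3 * (B₀ * (1 - 1 * b)) ^ 3 * C₁ ^ 2 := by rw [e2, e3]
        _ = C₁ ^ 2 * (A₀ ^ 3 * B₀ ^ 3 * ((1 - 1 * a) ^ 3 * (1 - 1 * b) ^ 3)) := by ring
    exact (pow_le_pow_iff_left₀ (mul_nonneg hκ0 hΦ10) hC₁ two_ne_zero).1 this
  -- chord
  have hchord : Φr ≤ 1 - r + r * Φ1 := Phi_le_chord ha hb hd ha1 hb1 hd1 hXS' hr0 hr1
  have hmain : κ * Φr ≤ (1 - r) * C₀ + r * C₁ := by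
    calc κ * Φr ≤ κ * (1 - r + r * Φ1) := mul_le_mul_of_nonneg_left hchord hκ0
      _ = (1 - r) * κ + r * (κ * Φ1) := by ring
      _ ≤ (1 - r) * C₀ + r * C₁ := by
        have := mul_le_mul_of_nonneg_left hκC₀ (sub_nonneg.2 hr1)
        have := mul_le_mul_of_nonneg_left hκC₁ hr0
        linarith
  -- square and un-normalise
  have hsq : (κ * Φr) ^ 2 ≤ ((1 - r) * C₀ + r * C₁) ^ 2 :=
    pow_le_pow_left₀ (mul_nonneg hκ0 hΦr0) hmain 2
  rw [mul_pow, hκsq, hΦrsq, div_mul_div_comm] at hsq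
  have hdenr : 0 < (1 - r * a) ^ 3 * (1 - r * b) ^ 3 := by positivity
  rw [div_le_iff₀ (mul_pos hden hdenr)] at hsq
  rw [eQ, eA, eB]
  calc (Q₀ * (1 - r * d)) ^ 6 = Q₀ ^ 6 * (1 - r * d) ^ 6 := by ring
    _ ≤ ((1 - r) * C₀ + r * C₁) ^ 2 * (A₀ ^ 3 * B₀ ^ 3 * ((1 - r * a) ^ 3 * (1 - r * b) ^ 3)) := hsq
    _ = (A₀ * (1 - r * a)) ^ 3 * (B₀ * (1 - r * b)) ^ 3 * ((1 - r) * C₀ + r * C₁) ^ 2 := by ring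

/-- **The form fed by the graph side.**  The cross condition follows from two covariance inequalities
`K_a = ΔQ_a·A₀ − ΔA·Q₀ ≥ 0`, `K_b = ΔQ_b·B₀ − ΔB·Q₀ ≥ 0` (van den Berg–Häggström–Kahn positive association of a cluster,
applied at the two non-port terminals) with `ΔQ_a + ΔQ_b = Q₀ − Q₁`, `ΔQ_a, ΔQ_b ≥ 0`:
indeed `T_a(s) = ΔQ_a·A(s) − ΔA·Q(s)` is affine with `T_a(0) = K_a`, `T_a(1) = K_a + ΔA·ΔQ_b`, and
`XS(s) = B(s)·T_a(s) + A(s)·T_b(s)`. [this work] -/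
theorem sextic_chord_of_cov {Q₀ Q₁ A₀ A₁ B₀ B₁ C₀ C₁ dQa dQb r : ℝ}
    (hQ₁ : 0 < Q₁) (hA₁ : 0 < A₁) (hA : A₁ ≤ A₀) (hB₁ : 0 < B₁) (hB : B₁ ≤ B₀)
    (hC₀ : 0 ≤ C₀) (hC₁ : 0 ≤ C₁) (hdQa : 0 ≤ dQa) (hdQb : 0 ≤ dQb) (hsum : Q₀ - Q₁ = dQa + dQb)
    (hKa : (A₀ - A₁) * Q₀ ≤ dQa * A₀) (hKb : (B₀ - B₁) * Q₀ ≤ dQb * B₀)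
    (h0 : Q₀ ^ 6 ≤ A₀ ^ 3 * B₀ ^ 3 * C₀ ^ 2) (h1 : Q₁ ^ 6 ≤ A₁ ^ 3 * B₁ ^ 3 * C₁ ^ 2)
    (hr0 : 0 ≤ r) (hr1 : r ≤ 1) :
    ((1 - r) * Q₀ + r * Q₁) ^ 6 ≤
      ((1 - r) * A₀ + r * A₁) ^ 3 * ((1 - r) * B₀ + r * B₁) ^ 3 * ((1 - r) * C₀ + r * C₁) ^ 2 := by
  have hQ : Q₁ ≤ Q₀ := by linarith
  refine sextic_chord hQ₁ hQ hA₁ hA hB₁ hB hC₀ hC₁ (fun s hs => ?_) h0 h1 hr0 hr1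
  obtain ⟨hs0, hs1⟩ := hs
  -- `T_a(s) ≥ 0`, `T_b(s) ≥ 0`
  have hTa : 0 ≤ dQa * ((1 - s) * A₀ + s * A₁) - (A₀ - A₁) * ((1 - s) * Q₀ + s * Q₁) := by
    have e : dQa * ((1 - s) * A₀ + s * A₁) - (A₀ - A₁) * ((1 - s) * Q₀ + s * Q₁) =
        (dQa * A₀ - (A₀ - A₁) * Q₀) + s * ((A₀ - A₁) * dQb) := by
      have : Q₁ = Q₀ - dQa - dQb := by linarith
      rw [this]; ring
    rw [e]
    have : 0 ≤ (A₀ - A₁) * dQb := mul_nonneg (sub_nonneg.2 hA) hdQb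
    nlinarith
  have hTb : 0 ≤ dQb * ((1 - s) * B₀ + s * B₁) - (B₀ - B₁) * ((1 - s) * Q₀ + s * Q₁) := by
    have e : dQb * ((1 - s) * B₀ + s * B₁) - (B₀ - B₁) * ((1 - s) * Q₀ + s * Q₁) =
        (dQb * B₀ - (B₀ - B₁) * Q₀) + s * ((B₀ - B₁) * dQa) := by
      have : Q₁ = Q₀ - dQa - dQb := by linarith
      rw [this]; ring
    rw [e]
    have : 0 ≤ (B₀ - B₁) * dQa := mul_nonneg (sub_nonneg.2 hB) hdQa
    nlinarith
  have hAs : 0 ≤ (1 - s) * A₀ + s * A₁ := by nlinarith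
  have hBs : 0 ≤ (1 - s) * B₀ + s * B₁ := by nlinarith
  have e : (Q₀ - Q₁) * ((1 - s) * A₀ + s * A₁) * ((1 - s) * B₀ + s * B₁) -
      ((1 - s) * Q₀ + s * Q₁) * ((A₀ - A₁) * ((1 - s) * B₀ + s * B₁) + (B₀ - B₁) * ((1 - s) * A₀ + s * A₁)) =
      ((1 - s) * B₀ + s * B₁) * (dQa * ((1 - s) * A₀ + s * A₁) - (A₀ - A₁) * ((1 - s) * Q₀ + s * Q₁)) +
      ((1 - s) * A₀ + s * A₁) * (dQb * ((1 - s) * B₀ + s * B₁) - (B₀ - B₁) * ((1 - s) * Q₀ + s * Q₁)) := by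
    rw [hsum]; ring
  nlinarith [mul_nonneg hBs hTa, mul_nonneg hAs hTb, e]

end Summit.CriticalPhenomena.PercolationContinuityZ3.Theorems.ThreePointIsoSexticChord
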